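import Summits.CriticalPhenomena.PercolationContinuityZ3.Theorems.PercNearOneGluingNoHeavyLowerTailAPLProfileAll
import Summits.CriticalPhenomena.PercolationContinuityZ3.Theorems.PercNearOneGluingNoHeavyLowerTailAPLFamilyEdge
import HarnessLib

/-!
# `NoHeavyLowerTail` (stmt-CriticalPhenomena-4575) — the ADMISSIBLE FAMILY of profile rows, part 3: EVERY ADMISSIBLE ROW `μ(S|b|c)^{α+β} ≤ μ(S∤bc)·μ(b∤Sc)^β·μ(c∤Sb)^α` HOLDS FOR EVERY FINITE WEIGHTED GRAPH

Support file (prover prim-ineq-gen-8 gen 38; `--supports stmt-CriticalPhenomena-4575`; memo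
run/shared/lean/prim/prim-ineq-gen-8/FINDING-gen38-APLG-ALL.md THEOREM 1).  No definitions, no named facts, no sorries.

`μ = prodBernoulli w` on the pairs of a finite vertex type `V`; vertices `a, b, c`; `x ↔ y` = joined by an open path (`openConn`).
A pair of real exponents `(α, β)` is ADMISSIBLE if `α ≥ 1`, `β ≥ 1` and `αβ(α+β+1) ≥ (α+β)²` (⟺ `1/α + 1/β ≤ 1 + 1/(α+β)`); gen 37's
APL-P is the member `(3/2,3/2)`, and the strongest members are `β = (s²+3)/(s²−1)`, `α = (s²+3)/(2(s+1))`, `s ≥ 3`.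
* **`family_glued`** — for EVERY admissible pair, every finite `S` and all `b, c`:
  `μ(U_S)^{α+β} ≤ μ(A_S)·μ(B_S)^β·μ(C_S)^α` (`U_S = {¬S~b, ¬S~c, b↮c}`, `A_S = {¬S~b, ¬S~c}`, `B_S = {¬S~b, b↮c}`, `C_S = {¬S~c, b↮c}`),
  by gen 37's induction (conditioning on one pair leaving `S`, ROW Π) with LEMMA Q_{αβ} (`family_edge_mixture'`);
* **`family_all`** — the row for every finite weighted graph: `μ(a|b|c)^{α+β} ≤ μ(a∤bc)·μ(b∤ac)^β·μ(c∤ab)^α`;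
  `family_all_s5` — the member `s = 5` in natural-number exponents: `μ(a|b|c)²¹ ≤ μ(a∤bc)⁶·μ(b∤ac)⁷·μ(c∤ab)¹⁴`.
The envelope of the family lies strictly inside gen 29's APL-G cone; the consequence APL-G `(TD − e)² ≤ u_ab·u_ac` for every finite weighted
graph (and the quantitative Gladkov–Zimin Conjecture 6.3) is drawn in `…APLGeometricAll`. [this work]
-/

noncomputable section

namespace Summit.CriticalPhenomena.PercolationContinuityZ3.Theorems

namespace APL

open MeasureTheory Set Literature.Probability.Percolation Literature.Probability.LatticeModels
open Literature.Probability.Percolation.KNPreFKG (openConn_symm)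
open scoped Classical

variable {V : Type*} [Fintype V]

/-! ### The induction -/

set_option maxHeartbeats 4000000 in
/-- **Every ADMISSIBLE profile row, for every glued apex set** (memo THEOREM 1).  For an admissible pair `(α,β)` (`α, β ≥ 1`,
`αβ(α+β+1) ≥ (α+β)²`), every weight function `w`, every finite set `S` of vertices and all `b, c`:
`μ(U_S)^{α+β} ≤ μ(A_S) · μ(B_S)^β · μ(C_S)^α`.  Induction on the number of non-loop pairs of positive weight, exactly as gen 37's `profile_glued`,
with LEMMA Q_{αβ} (`family_edge_mixture'`) in place of LEMMA Q. [this work] -/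
theorem family_glued (α β : ℝ) (hα : 1 ≤ α) (hβ : 1 ≤ β) (hadm : (α + β) ^ 2 ≤ α * β * (α + β + 1)) (b c : V) :
    ∀ (n : ℕ) (w : Sym2 V → unitInterval) (S : Finset V),
      (Finset.univ.filter fun f : Sym2 V => ¬ f.IsDiag ∧ 0 < (w f : ℝ)).card = n →
      (prodBernoulli w).real ((⋃ u ∈ (↑S : Set V), (openConn u b : Set (BondConfig V)))ᶜ
          ∩ (⋃ u ∈ (↑S : Set V), (openConn u c : Set (BondConfig V)))ᶜ ∩ (openConn b c : Set (BondConfig V))ᶜ) ^ (α + β) ≤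
        (prodBernoulli w).real ((⋃ u ∈ (↑S : Set V), (openConn u b : Set (BondConfig V)))ᶜ
            ∩ (⋃ u ∈ (↑S : Set V), (openConn u c : Set (BondConfig V)))ᶜ) *
          (prodBernoulli w).real ((⋃ u ∈ (↑S : Set V), (openConn u b : Set (BondConfig V)))ᶜ ∩ (openConn b c : Set (BondConfig V))ᶜ) ^ β *
          (prodBernoulli w).real ((⋃ u ∈ (↑S : Set V), (openConn u c : Set (BondConfig V)))ᶜ ∩ (openConn b c : Set (BondConfig V))ᶜ) ^ α := by
  have hα0 : 0 ≤ α := zero_le_one.trans hα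
  have hβ0 : 0 ≤ β := zero_le_one.trans hβ
  have hn : α + β ≠ 0 := by linarith
  intro n
  induction n using Nat.strong_induction_on with
  | _ n ih =>
  intro w S hcard
  -- (0) a target inside the glued set: the `U`-event is empty
  by_cases hbS : b ∈ S
  · have hempty : ((⋃ u ∈ (↑S : Set V), (openConn u b : Set (BondConfig V)))ᶜ
        ∩ (⋃ u ∈ (↑S : Set V), (openConn u c : Set (BondConfig V)))ᶜ ∩ (openConn b c : Set (BondConfig V))ᶜ) = ∅ := by
      ext ω
      simp only [mem_inter_iff, mem_compl_iff, mem_iUnion, exists_prop, mem_empty_iff_false, iff_false, not_and, not_not]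
      intro h
      exact absurd ⟨b, Finset.mem_coe.2 hbS, (SimpleGraph.Reachable.refl b : ω ∈ (openConn b b : Set (BondConfig V)))⟩ h.1
    rw [hempty, measureReal_empty, Real.zero_rpow hn]
    exact mul_nonneg (mul_nonneg measureReal_nonneg (Real.rpow_nonneg measureReal_nonneg _)) (Real.rpow_nonneg measureReal_nonneg _)
  by_cases hcS : c ∈ S
  · have hempty : ((⋃ u ∈ (↑S : Set V), (openConn u b : Set (BondConfig V)))ᶜ
        ∩ (⋃ u ∈ (↑S : Set V), (openConn u c : Set (BondConfig V)))ᶜ ∩ (openConn b c : Set (BondConfig V))ᶜ) = ∅ := by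
      ext ω
      simp only [mem_inter_iff, mem_compl_iff, mem_iUnion, exists_prop, mem_empty_iff_false, iff_false, not_and, not_not]
      intro h
      exact absurd ⟨c, Finset.mem_coe.2 hcS, (SimpleGraph.Reachable.refl c : ω ∈ (openConn c c : Set (BondConfig V)))⟩ h.2
    rw [hempty, measureReal_empty, Real.zero_rpow hn]
    exact mul_nonneg (mul_nonneg measureReal_nonneg (Real.rpow_nonneg measureReal_nonneg _)) (Real.rpow_nonneg measureReal_nonneg _)
  by_cases hlive : ∃ s ∈ S, ∃ t, t ∉ S ∧ 0 < (w s(s, t) : ℝ)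
  · -- (1) a live pair leaving `S`: condition on it
    obtain ⟨s, hs, t, ht, hpos⟩ := hlive
    have hst : s ≠ t := fun h => ht (h ▸ hs)
    have hed : ¬ (s(s, t)).IsDiag := by rwa [Sym2.mk_isDiag_iff]
    set w0 := pinW w ({s(s, t)} : Set (Sym2 V)) (∅ : Set (Sym2 V)) with hw0
    have hcard0 : (Finset.univ.filter fun f : Sym2 V => ¬ f.IsDiag ∧ 0 < (w0 f : ℝ)).card < n := by
      rw [hw0, support_pin_zero w s(s, t), Finset.card_erase_of_mem, hcard]
      · have : 0 < n := by
          rw [← hcard]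
          exact Finset.card_pos.2 ⟨s(s, t), Finset.mem_filter.2 ⟨Finset.mem_univ _, hed, hpos⟩⟩
        omega
      · exact Finset.mem_filter.2 ⟨Finset.mem_univ _, hed, hpos⟩
    have IH0 := ih _ hcard0 w0 S rfl
    have IH1 := ih _ hcard0 w0 (insert t S) rfl
    rw [Finset.coe_insert] at IH1
    -- the four decompositions `X = (1 - z) X₀ + z X₁`
    have eU := real_eq_pin_zero_add_pin_one w s(s, t) ((⋃ u ∈ (↑S : Set V), (openConn u b : Set (BondConfig V)))ᶜ
        ∩ (⋃ u ∈ (↑S : Set V), (openConn u c : Set (BondConfig V)))ᶜ ∩ (openConn b c : Set (BondConfig V))ᶜ)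
    have eA := real_eq_pin_zero_add_pin_one w s(s, t) ((⋃ u ∈ (↑S : Set V), (openConn u b : Set (BondConfig V)))ᶜ
        ∩ (⋃ u ∈ (↑S : Set V), (openConn u c : Set (BondConfig V)))ᶜ)
    have eB := real_eq_pin_zero_add_pin_one w s(s, t) ((⋃ u ∈ (↑S : Set V), (openConn u b : Set (BondConfig V)))ᶜ
        ∩ (openConn b c : Set (BondConfig V))ᶜ)
    have eC := real_eq_pin_zero_add_pin_one w s(s, t) ((⋃ u ∈ (↑S : Set V), (openConn u c : Set (BondConfig V)))ᶜ
        ∩ (openConn b c : Set (BondConfig V))ᶜ)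
    rw [pin_one_U w S hs ht b c] at eU
    rw [pin_one_A w S hs ht b c] at eA
    rw [pin_one_B w S hs ht b c] at eB
    rw [pin_one_C w S hs ht b c] at eC
    rw [← hw0] at eU eA eB eC
    rw [eU, eA, eB, eC]
    -- nonnegativity / monotonicity of the endpoint values
    have subU : ((⋃ u ∈ insert t (↑S : Set V), (openConn u b : Set (BondConfig V)))ᶜ
        ∩ (⋃ u ∈ insert t (↑S : Set V), (openConn u c : Set (BondConfig V)))ᶜ ∩ (openConn b c : Set (BondConfig V))ᶜ) ⊆
        ((⋃ u ∈ (↑S : Set V), (openConn u b : Set (BondConfig V)))ᶜ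
        ∩ (⋃ u ∈ (↑S : Set V), (openConn u c : Set (BondConfig V)))ᶜ ∩ (openConn b c : Set (BondConfig V))ᶜ) := by
      intro ω hω
      simp only [mem_inter_iff, mem_compl_iff, mem_iUnion, exists_prop, not_exists, not_and] at hω ⊢
      exact ⟨⟨fun u hu => hω.1.1 u (mem_insert_of_mem _ hu), fun u hu => hω.1.2 u (mem_insert_of_mem _ hu)⟩, hω.2⟩
    have subB : ((⋃ u ∈ insert t (↑S : Set V), (openConn u b : Set (BondConfig V)))ᶜ ∩ (openConn b c : Set (BondConfig V))ᶜ) ⊆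
        ((⋃ u ∈ (↑S : Set V), (openConn u b : Set (BondConfig V)))ᶜ ∩ (openConn b c : Set (BondConfig V))ᶜ) := by
      intro ω hω
      simp only [mem_inter_iff, mem_compl_iff, mem_iUnion, exists_prop, not_exists, not_and] at hω ⊢
      exact ⟨fun u hu => hω.1 u (mem_insert_of_mem _ hu), hω.2⟩
    have subC : ((⋃ u ∈ insert t (↑S : Set V), (openConn u c : Set (BondConfig V)))ᶜ ∩ (openConn b c : Set (BondConfig V))ᶜ) ⊆
        ((⋃ u ∈ (↑S : Set V), (openConn u c : Set (BondConfig V)))ᶜ ∩ (openConn b c : Set (BondConfig V))ᶜ) := by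
      intro ω hω
      simp only [mem_inter_iff, mem_compl_iff, mem_iUnion, exists_prop, not_exists, not_and] at hω ⊢
      exact ⟨fun u hu => hω.1 u (mem_insert_of_mem _ hu), hω.2⟩
    have key := family_edge_mixture' α β hα hβ hadm
      ((prodBernoulli w0).real ((⋃ u ∈ (↑S : Set V), (openConn u b : Set (BondConfig V)))ᶜ
        ∩ (⋃ u ∈ (↑S : Set V), (openConn u c : Set (BondConfig V)))ᶜ ∩ (openConn b c : Set (BondConfig V))ᶜ))
      ((prodBernoulli w0).real ((⋃ u ∈ insert t (↑S : Set V), (openConn u b : Set (BondConfig V)))ᶜ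
        ∩ (⋃ u ∈ insert t (↑S : Set V), (openConn u c : Set (BondConfig V)))ᶜ ∩ (openConn b c : Set (BondConfig V))ᶜ))
      ((prodBernoulli w0).real ((⋃ u ∈ (↑S : Set V), (openConn u b : Set (BondConfig V)))ᶜ
        ∩ (⋃ u ∈ (↑S : Set V), (openConn u c : Set (BondConfig V)))ᶜ))
      ((prodBernoulli w0).real ((⋃ u ∈ insert t (↑S : Set V), (openConn u b : Set (BondConfig V)))ᶜ
        ∩ (⋃ u ∈ insert t (↑S : Set V), (openConn u c : Set (BondConfig V)))ᶜ))
      ((prodBernoulli w0).real ((⋃ u ∈ (↑S : Set V), (openConn u b : Set (BondConfig V)))ᶜ ∩ (openConn b c : Set (BondConfig V))ᶜ))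
      ((prodBernoulli w0).real ((⋃ u ∈ insert t (↑S : Set V), (openConn u b : Set (BondConfig V)))ᶜ ∩ (openConn b c : Set (BondConfig V))ᶜ))
      ((prodBernoulli w0).real ((⋃ u ∈ (↑S : Set V), (openConn u c : Set (BondConfig V)))ᶜ ∩ (openConn b c : Set (BondConfig V))ᶜ))
      ((prodBernoulli w0).real ((⋃ u ∈ insert t (↑S : Set V), (openConn u c : Set (BondConfig V)))ᶜ ∩ (openConn b c : Set (BondConfig V))ᶜ))
      measureReal_nonneg (measureReal_mono subU) measureReal_nonneg measureReal_nonneg measureReal_nonneg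
      (measureReal_mono subB) measureReal_nonneg (measureReal_mono subC) IH0 IH1 (rowPi_glued w0 S t b c)
      (w s(s, t) : ℝ) ⟨(w s(s, t)).2.1, (w s(s, t)).2.2⟩
    exact key
  · -- (2) no live pair leaves `S`: the glued set is a.s. isolated
    push Not at hlive
    have hnull : ∀ x, x ∉ S → (prodBernoulli w).real (⋃ u ∈ (↑S : Set V), (openConn u x : Set (BondConfig V))) = 0 := by
      intro x hx
      have hsub : (⋃ u ∈ (↑S : Set V), (openConn u x : Set (BondConfig V))) ⊆
          {ω : BondConfig V | ∃ i ∈ (Finset.univ.filter fun f : Sym2 V => ∃ s ∈ S, ∃ t, t ∉ S ∧ f = s(s, t)), i ∈ ω} := by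
        intro ω hω
        simp only [mem_iUnion, exists_prop] at hω
        obtain ⟨u, hu, hux⟩ := hω
        obtain ⟨s, hs, t, htS, hst⟩ := exists_crossing_of_setConn (S := (↑S : Set V)) (fun h => hx (Finset.mem_coe.1 h)) ⟨u, hu, hux⟩
        exact ⟨s(s, t), Finset.mem_filter.2 ⟨Finset.mem_univ _, s, Finset.mem_coe.1 hs, t, fun h => htS (Finset.mem_coe.2 h), rfl⟩, hst⟩
      have hle := (measureReal_mono hsub).trans (prodBernoulli_real_exists_mem_le_sum w _)
      have hsum : ∑ i ∈ (Finset.univ.filter fun f : Sym2 V => ∃ s ∈ S, ∃ t, t ∉ S ∧ f = s(s, t)), (w i : ℝ) = 0 := by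
        refine Finset.sum_eq_zero fun i hi => ?_
        obtain ⟨s, hs, t, ht, rfl⟩ := (Finset.mem_filter.1 hi).2
        exact le_antisymm (hlive s hs t ht) (w s(s, t)).2.1
      rw [hsum] at hle
      exact le_antisymm hle measureReal_nonneg
    have nb : (prodBernoulli w) (⋃ u ∈ (↑S : Set V), (openConn u b : Set (BondConfig V))) = 0 :=
      (measureReal_eq_zero_iff (measure_ne_top _ _)).1 (hnull b hbS)
    have nc : (prodBernoulli w) (⋃ u ∈ (↑S : Set V), (openConn u c : Set (BondConfig V))) = 0 :=
      (measureReal_eq_zero_iff (measure_ne_top _ _)).1 (hnull c hcS)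
    have nbc := measure_union_null nb nc
    -- every event below differs from its `S = ∅` version by a subset of the null set `{S~b} ∪ {S~c}`
    have hU : (prodBernoulli w).real ((⋃ u ∈ (↑S : Set V), (openConn u b : Set (BondConfig V)))ᶜ
        ∩ (⋃ u ∈ (↑S : Set V), (openConn u c : Set (BondConfig V)))ᶜ ∩ (openConn b c : Set (BondConfig V))ᶜ) =
        (prodBernoulli w).real ((openConn b c : Set (BondConfig V))ᶜ) := by
      refine measureReal_congr (ae_eq_set.2 ⟨measure_mono_null (fun ω h => (h.2 h.1.2).elim) measure_empty,
        measure_mono_null (fun ω h => ?_) nbc⟩)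
      by_contra hω
      simp only [mem_union, not_or] at hω
      exact h.2 ⟨⟨hω.1, hω.2⟩, h.1⟩
    have hA : (prodBernoulli w).real ((⋃ u ∈ (↑S : Set V), (openConn u b : Set (BondConfig V)))ᶜ
        ∩ (⋃ u ∈ (↑S : Set V), (openConn u c : Set (BondConfig V)))ᶜ) = 1 := by
      rw [← probReal_univ (μ := prodBernoulli w)]
      refine measureReal_congr (ae_eq_set.2 ⟨measure_mono_null (fun ω h => (h.2 (mem_univ ω)).elim) measure_empty,
        measure_mono_null (fun ω h => ?_) nbc⟩)
      by_contra hω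
      simp only [mem_union, not_or] at hω
      exact h.2 ⟨hω.1, hω.2⟩
    have hB : (prodBernoulli w).real ((⋃ u ∈ (↑S : Set V), (openConn u b : Set (BondConfig V)))ᶜ
        ∩ (openConn b c : Set (BondConfig V))ᶜ) = (prodBernoulli w).real ((openConn b c : Set (BondConfig V))ᶜ) := by
      refine measureReal_congr (ae_eq_set.2 ⟨measure_mono_null (fun ω h => (h.2 h.1.2).elim) measure_empty,
        measure_mono_null (fun ω h => ?_) nbc⟩)
      by_contra hω
      simp only [mem_union, not_or] at hω
      exact h.2 ⟨hω.1, h.1⟩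
    have hC : (prodBernoulli w).real ((⋃ u ∈ (↑S : Set V), (openConn u c : Set (BondConfig V)))ᶜ
        ∩ (openConn b c : Set (BondConfig V))ᶜ) = (prodBernoulli w).real ((openConn b c : Set (BondConfig V))ᶜ) := by
      refine measureReal_congr (ae_eq_set.2 ⟨measure_mono_null (fun ω h => (h.2 h.1.2).elim) measure_empty,
        measure_mono_null (fun ω h => ?_) nbc⟩)
      by_contra hω
      simp only [mem_union, not_or] at hω
      exact h.2 ⟨hω.2, h.1⟩
    rw [hU, hA, hB, hC, one_mul, add_comm α β, Real.rpow_add' measureReal_nonneg (by rwa [add_comm] : β + α ≠ 0)]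

/-! ### The row for every finite weighted graph -/

/-- **Every ADMISSIBLE profile row FOR EVERY FINITE WEIGHTED GRAPH** (memo THEOREM 1, `S = {a}`): for `α, β ≥ 1` with `αβ(α+β+1) ≥ (α+β)²`,
`μ(a|b|c)^{α+β} ≤ μ(a∤bc) · μ(b∤ac)^β · μ(c∤ab)^α`.  (`(3/2,3/2)` is APL-P; `β = (s²+3)/(s²−1)`, `α = (s²+3)/(2(s+1))`, `s ≥ 3`, are the
strongest members.) [this work] -/
theorem family_all (α β : ℝ) (hα : 1 ≤ α) (hβ : 1 ≤ β) (hadm : (α + β) ^ 2 ≤ α * β * (α + β + 1))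
    (w : Sym2 V → unitInterval) (a b c : V) :
    (prodBernoulli w).real ((openConn a b)ᶜ ∩ (openConn a c)ᶜ ∩ (openConn b c)ᶜ : Set (BondConfig V)) ^ (α + β) ≤
      (prodBernoulli w).real ((openConn a b)ᶜ ∩ (openConn a c)ᶜ : Set (BondConfig V)) *
        (prodBernoulli w).real ((openConn a b)ᶜ ∩ (openConn b c)ᶜ : Set (BondConfig V)) ^ β *
        (prodBernoulli w).real ((openConn a c)ᶜ ∩ (openConn b c)ᶜ : Set (BondConfig V)) ^ α := by
  have h := family_glued α β hα hβ hadm b c _ w ({a} : Finset V) rfl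
  simp only [Finset.coe_singleton, biUnion_singleton] at h
  exact h


/-- `(x ^ r) ^ n = x ^ (r·n)` as a natural power, for `x ≥ 0`. [folklore] -/
theorem rpow_pow_eq_pow (x r : ℝ) (n m : ℕ) (hx : 0 ≤ x) (h : r * n = m) : (x ^ r) ^ n = x ^ m := by
  rw [← Real.rpow_natCast (x ^ r) n, ← Real.rpow_mul hx, h, Real.rpow_natCast]

/-- **The member `s = 5` in natural-number exponents**: `μ(a|b|c)²¹ ≤ μ(a∤bc)⁶ · μ(b∤ac)⁷ · μ(c∤ab)¹⁴` for every finite weighted graph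
(`(α,β) = (7/3, 7/6)`; compare APL-P `μ(a|b|c)⁶ ≤ μ(a∤bc)²μ(b∤ac)³μ(c∤ab)³`). [this work] -/
theorem family_all_s5 (w : Sym2 V → unitInterval) (a b c : V) :
    (prodBernoulli w).real ((openConn a b)ᶜ ∩ (openConn a c)ᶜ ∩ (openConn b c)ᶜ : Set (BondConfig V)) ^ 21 ≤
      (prodBernoulli w).real ((openConn a b)ᶜ ∩ (openConn a c)ᶜ : Set (BondConfig V)) ^ 6 *
        (prodBernoulli w).real ((openConn a b)ᶜ ∩ (openConn b c)ᶜ : Set (BondConfig V)) ^ 7 *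
        (prodBernoulli w).real ((openConn a c)ᶜ ∩ (openConn b c)ᶜ : Set (BondConfig V)) ^ 14 := by
  have h := family_all (7 / 3) (7 / 6) (by norm_num) (by norm_num) (by norm_num) w a b c
  have hU : (0 : ℝ) ≤ (prodBernoulli w).real ((openConn a b)ᶜ ∩ (openConn a c)ᶜ ∩ (openConn b c)ᶜ : Set (BondConfig V)) :=
    measureReal_nonneg
  have hB : (0 : ℝ) ≤ (prodBernoulli w).real ((openConn a b)ᶜ ∩ (openConn b c)ᶜ : Set (BondConfig V)) := measureReal_nonneg
  have hC : (0 : ℝ) ≤ (prodBernoulli w).real ((openConn a c)ᶜ ∩ (openConn b c)ᶜ : Set (BondConfig V)) := measureReal_nonneg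
  have h6 := pow_le_pow_left₀ (Real.rpow_nonneg hU _) h 6
  rw [mul_pow, mul_pow, rpow_pow_eq_pow _ _ 6 21 hU (by norm_num), rpow_pow_eq_pow _ _ 6 7 hB (by norm_num),
    rpow_pow_eq_pow _ _ 6 14 hC (by norm_num)] at h6
  exact h6

end APL

end Summit.CriticalPhenomena.PercolationContinuityZ3.Theorems

end
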